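import Literature.AlgebraicGeometry.ComplexMultiplication.CMTorusProductsHodgeClassesPohlmann
import Literature.NumberTheory.ComplexMultiplication.CMAlgebraTorusIsogenyClass
import Literature.Geometry.Kaehler.ComplexTorusIdempotentRelations
import HarnessLib

/-!
# Pohlmann's count «for an arbitrary CM abelian variety `A` associated with the CM pair `(E, Φ)`»: for EVERY complex
# torus with multiplication by a CM-algebra `Y = L₁ ⊕ ⋯ ⊕ L_t` of full degree, `dim_ℚ Bᵖ(X) = #pohlmannSetsAlg (Φᵢ)ᵢ p`
# and `ρ(X) = #pohlmannSetsAlg (Φᵢ)ᵢ 1` (Gao–Ullmo 2025 Thm. 3.1 after Pohlmann 1968 Thm. 1; Shimura 1998 §18.7)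

Topic `Literature/AlgebraicGeometry/ComplexMultiplication`, namespace `Literature.NumberTheory.ComplexMultiplication.IsCMAlgTorusRat`;
lane `lit-hodgefound` (Track 2 foundations library), Layers A3/A4, seat p19 generation 25, row g25-#8 — the JUNCTION of
p19's torus-level CM-algebra series (`NumberTheory/ComplexMultiplication/CMAlgebraTorus*.lean`: the class
`IsCMAlgTorusRat P ρ` of a torus `X = E/P(ℤ^ι)` with a ring-injection `ρ : Y = ∏ᵢ Lᵢ → End_ℚ(X)`, `[Y : ℚ] = 2 dim X`,
its CM types `h.cmType i : CMType (Lᵢ)` and **`isIsogenous_sigmaPi_periodEquiv`**: `X ∼ ∏ᵢ ℂ^{Φᵢ}/u(𝔪ᵢ)` for ANY lattices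
`𝔪ᵢ`, Shimura §18.7) with the Pohlmann file of the product tori
(`AlgebraicGeometry/ComplexMultiplication/CMTorusProductsHodgeClassesPohlmann.lean`:
`CMTorus.finrank_hodgeClasses_eq_ncard_pohlmannSetsAlg_of_isIsogenous` — every torus ISOGENOUS to
`∏ᵢ ℂ^{Φᵢ}/u(𝔪ᵢ)` (`i : Fin n`) has `dim_ℚ Bᵖ = #pohlmannSetsAlg Φ p`, `dim_ℚ H^{2p}_Hodge` being an isogeny invariant).
Gao–Ullmo's `A` «associated with the CM pair `(E, Φ)`» is exactly a torus with `IsCMAlgTorusRat`; this file says so.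
THEOREMS ONLY: no definition, no named fact (net debt 0).

## Sources, VERBATIM

* Z. Gao, E. Ullmo, *Hodge cycles and quadratic relations between holomorphic periods on CM abelian varieties* (2025)
  [GaoUllmo2025], §3.1 Theorem 3.1 "(Pohlmann)" (held `paper:galaxy-pdf-4667137180` p0012 L3–L16): «Let `A` be a CM
  abelian variety, associated with the CM pair `(E, Φ)`. … In particular `dim_ℚ Bᵖ(A)` is the number of ordered
  `P ∈ 𝒫(S)` with `|P| = 2p` satisfying (3.2). Proof. Pohlmann [Poh68, Thm. 1] states this result when `A` is simple.
  The proof remains valid for an arbitrary CM abelian variety `A`.»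
* H. Pohlmann, *Algebraic cycles on abelian varieties of complex multiplication type*, Ann. of Math. 88 (1968)
  [Pohlmann1968], Thm. 1.
* G. Shimura, *Abelian Varieties with Complex Multiplication and Modular Functions* (1998) [Shimura1998], §18.7
  (p. 129): «`A` is isogenous to `A_1 × ⋯ × A_t` … `(A_i, ι_i)` determines a CM-type `(K_i, Φ_i)`».
* H. Lange, *Abelian Varieties over the Complex Numbers* (2023) [Lange2023AbelianVarietiesComplex], §7.3.3 Exercise (1)(a)
  (`dim H^{2p}_Hodge` is an isogeny invariant), §1.3.4 Exercise (10)(b) (`ρ(X) = rk NS(X)`), §2.4.4 Thm. 2.4.25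
  («uniquely determined up to isogenies and permutations»).

## What this file proves (all sorry-free)

For `h : IsCMAlgTorusRat P ρ` (`L : t → Type` number fields, `t` any finite index type) and a numbering `e : Fin n ≃ t`
of the factors (Pohlmann's index set `pohlmannSetsAlg` is stated for families over `Fin n`):
* `isIsogenous_sigmaPi_periodEquiv_compEquiv` — `X ∼ ∏_{j < n} ℂ^{Φ_{e j}}/u(𝔪_{e j})` (reindexing «up to permutations»);
* **`finrank_hodgeClasses_eq_ncard_pohlmannSetsAlg`** — `dim_ℚ Bᵖ(X) = #pohlmannSetsAlg (j ↦ Φ_{e j}) p` for every `p`;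
* **`finrank_neronSeveriGroup_eq_ncard_pohlmannSetsAlg`** — the Picard number `ρ(X) = rk NS(X) = #pohlmannSetsAlg (j ↦ Φ_{e j}) 1`;
* the `Fin n`-indexed forms `finrank_hodgeClasses_eq_ncard_pohlmannSetsAlg_fin`, `finrank_neronSeveriGroup_eq_ncard_pohlmannSetsAlg_fin`
  (no reindexing);
* `finrank_hodgeClasses_eq_of_cmType_eq`, `finrank_neronSeveriGroup_eq_of_cmType_eq` — tori with multiplication by `Y`
  of the same type (one isogeny class, g21-#7 / g25-#7) have the same `dim_ℚ Bᵖ` and the same Picard number.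

## References

* [GaoUllmo2025] Z. Gao, E. Ullmo, J. Inst. Math. Jussieu 25 (2025), §3.1 Thm. 3.1.
* [Pohlmann1968] H. Pohlmann, Ann. of Math. (2) 88 (1968) 161–180, Thm. 1.
* [Shimura1998] G. Shimura, *Abelian Varieties with Complex Multiplication and Modular Functions*, Princeton (1998), §18.7.
* [Lange2023AbelianVarietiesComplex] H. Lange, *Abelian Varieties over the Complex Numbers*, Springer (2023), §1.3.4
  Exercise (10)(b), §2.4.4 Thm. 2.4.25, §7.3.3 Exercise (1)(a).
-/

noncomputable section

open scoped Classical
open Module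

namespace Literature.NumberTheory.ComplexMultiplication

open Literature.AlgebraicGeometry.Motives (CMType)
open Literature.AlgebraicGeometry.Pohlmann1968 (pohlmannSetsAlg)
open Literature.AlgebraicGeometry.ComplexMultiplication (CMTorus.periodEquiv)
open Literature.Geometry.Kaehler
open Literature.Geometry.Kaehler.ComplexTorus

namespace IsCMAlgTorusRat

section Reindex

variable {t : Type} {L : t → Type} [∀ i, Field (L i)] [∀ i, NumberField (L i)] [Fintype t] [DecidableEq t]
variable {ι : Type} [Fintype ι] [DecidableEq ι] {E : Type} [NormedAddCommGroup E] [NormedSpace ℂ E]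
  {P : (ι → ℝ) ≃L[ℝ] E} {ρ : (Π i, L i) →ₐ[ℚ] Matrix ι ι ℚ}

/-- **`X ∼ ∏_{j} ℂ^{Φ_{e j}}/u(𝔪_{e j})` for any renumbering `e : κ ≃ t` of the factors** («up to isogenies and
permutations»). [cite: Shimura1998, §18.7 («`A` is isogenous to `A_1 × ⋯ × A_t`»), p. 129] [cite: Lange2023AbelianVarietiesComplex, §2.4.4 Thm. 2.4.25, p. 123] -/
theorem isIsogenous_sigmaPi_periodEquiv_compEquiv (h : IsCMAlgTorusRat P ρ) {κ : Type} [Fintype κ] [DecidableEq κ]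
    (e : κ ≃ t) {σ : t → Type} [∀ i, Fintype (σ i)] [∀ i, DecidableEq (σ i)] (μ : ∀ i, Basis (σ i) ℚ (L i)) :
    IsIsogenous P (sigmaPiPeriod fun j => CMTorus.periodEquiv (h.cmType (e j)) (μ (e j))) :=
  IsIsogenous.trans _ _ _ (h.isIsogenous_sigmaPi_periodEquiv μ)
    (IsIsogenous.symm _ _ (isIsogenous_sigmaPiPeriod_comp_equiv
      (fun i => CMTorus.periodEquiv (h.cmType i) (μ i)) e))

/-- **POHLMANN'S COUNT FOR EVERY TORUS WITH MULTIPLICATION BY A CM-ALGEBRA: `dim_ℚ Bᵖ(X) = #pohlmannSetsAlg (Φ_{e j})_j p`**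
(«Let `A` be a CM abelian variety, associated with the CM pair `(E, Φ)` … `dim_ℚ Bᵖ(A)` is the number of … `P` …
satisfying (3.2)» — `E = Y = ∏ᵢ Lᵢ`, `Φ = ⊔ᵢ Φᵢ`; through `X ∼ ∏_j ℂ^{Φ_{e j}}/u(𝒪)` and the isogeny invariance of
`dim_ℚ H^{2p}_Hodge`). [cite: GaoUllmo2025, §3.1 Thm. 3.1] [cite: Pohlmann1968, Thm. 1] [cite: Lange2023AbelianVarietiesComplex, §7.3.3 Exercise (1)(a)] -/
theorem finrank_hodgeClasses_eq_ncard_pohlmannSetsAlg (h : IsCMAlgTorusRat P ρ) {n : ℕ} (e : Fin n ≃ t) (p : ℕ) :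
    finrank ℚ (hodgeClasses P p) = (pohlmannSetsAlg (fun j => h.cmType (e j)) p).ncard :=
  Literature.AlgebraicGeometry.ComplexMultiplication.CMTorus.finrank_hodgeClasses_eq_ncard_pohlmannSetsAlg_of_isIsogenous
    (fun j => h.cmType (e j)) (fun j => Module.finBasis ℚ (L (e j)))
    (h.isIsogenous_sigmaPi_periodEquiv_compEquiv e fun i => Module.finBasis ℚ (L i)) p

/-- **THE PICARD NUMBER OF A TORUS WITH MULTIPLICATION BY A CM-ALGEBRA: `ρ(X) = rk NS(X) = #pohlmannSetsAlg (Φ_{e j})_j 1`**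
(the balanced pairs of embeddings of `Y`; Lefschetz `(1,1)` and the case `p = 1`).
[cite: GaoUllmo2025, §3.1 Thm. 3.1] [cite: Lange2023AbelianVarietiesComplex, §1.3.4 Exercise (10)(b) and §7.3.3 Exercise (1)(a)] -/
theorem finrank_neronSeveriGroup_eq_ncard_pohlmannSetsAlg (h : IsCMAlgTorusRat P ρ) {n : ℕ} (e : Fin n ≃ t) :
    finrank ℤ (neronSeveriGroup P) = (pohlmannSetsAlg (fun j => h.cmType (e j)) 1).ncard :=
  Literature.AlgebraicGeometry.ComplexMultiplication.CMTorus.finrank_neronSeveriGroup_eq_ncard_pohlmannSetsAlg_of_isIsogenous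
    (fun j => h.cmType (e j)) (fun j => Module.finBasis ℚ (L (e j)))
    (h.isIsogenous_sigmaPi_periodEquiv_compEquiv e fun i => Module.finBasis ℚ (L i))

/-- With the canonical numbering `Fin (card t) ≃ t`. [cite: GaoUllmo2025, §3.1 Thm. 3.1] [cite: Pohlmann1968, Thm. 1] -/
theorem finrank_hodgeClasses_eq_ncard_pohlmannSetsAlg_equivFin (h : IsCMAlgTorusRat P ρ) (p : ℕ) :
    finrank ℚ (hodgeClasses P p) =
      (pohlmannSetsAlg (fun j => h.cmType ((Fintype.equivFin t).symm j)) p).ncard :=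
  h.finrank_hodgeClasses_eq_ncard_pohlmannSetsAlg (Fintype.equivFin t).symm p

/-- **Tori with multiplication by `Y` of the same type have the same `dim_ℚ Bᵖ`** (they are isogenous, g21-#7).
[cite: Shimura1998, §6.1 Cor. of Thm. 2, p. 41; §18.7, p. 129] [cite: Lange2023AbelianVarietiesComplex, §7.3.3 Exercise (1)(a)] -/
theorem finrank_hodgeClasses_eq_of_cmType_eq (h : IsCMAlgTorusRat P ρ) {ι' : Type} [Fintype ι'] [DecidableEq ι']
    {E' : Type} [NormedAddCommGroup E'] [NormedSpace ℂ E'] {P' : (ι' → ℝ) ≃L[ℝ] E'}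
    {ρ' : (Π i, L i) →ₐ[ℚ] Matrix ι' ι' ℚ} (h' : IsCMAlgTorusRat P' ρ') (hΦ : ∀ i, h.cmType i = h'.cmType i) (p : ℕ) :
    finrank ℚ (hodgeClasses P p) = finrank ℚ (hodgeClasses P' p) := by
  obtain ⟨A, hA, -⟩ := h.exists_isIsogeny_equivariant h' hΦ
  exact IsIsogenous.finrank_hodgeClasses_eq _ _ ⟨A, hA⟩ p

/-- **Tori with multiplication by `Y` of the same type have the same Picard number.**
[cite: Shimura1998, §6.1 Cor. of Thm. 2, p. 41; §18.7, p. 129] [cite: Lange2023AbelianVarietiesComplex, §1.3.4 Exercise (10)(b) and §7.3.3 Exercise (1)(a)] -/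
theorem finrank_neronSeveriGroup_eq_of_cmType_eq (h : IsCMAlgTorusRat P ρ) {ι' : Type} [Fintype ι'] [DecidableEq ι']
    {E' : Type} [NormedAddCommGroup E'] [NormedSpace ℂ E'] {P' : (ι' → ℝ) ≃L[ℝ] E'}
    {ρ' : (Π i, L i) →ₐ[ℚ] Matrix ι' ι' ℚ} (h' : IsCMAlgTorusRat P' ρ') (hΦ : ∀ i, h.cmType i = h'.cmType i) :
    finrank ℤ (neronSeveriGroup P) = finrank ℤ (neronSeveriGroup P') := by
  obtain ⟨A, hA, -⟩ := h.exists_isIsogeny_equivariant h' hΦ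
  exact IsIsogenous.finrank_neronSeveriGroup_eq _ _ ⟨A, hA⟩

end Reindex

/-! ### The `Fin n`-indexed statements (no renumbering) -/

section FinIndexed

variable {n : ℕ} {L : Fin n → Type} [∀ i, Field (L i)] [∀ i, NumberField (L i)]
variable {ι : Type} [Fintype ι] [DecidableEq ι] {E : Type} [NormedAddCommGroup E] [NormedSpace ℂ E]
  {P : (ι → ℝ) ≃L[ℝ] E} {ρ : (Π i, L i) →ₐ[ℚ] Matrix ι ι ℚ}

/-- **`dim_ℚ Bᵖ(X) = #pohlmannSetsAlg (Φᵢ)ᵢ p`** for a torus with multiplication by `Y = L₀ ⊕ ⋯ ⊕ L_{n-1}`.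
[cite: GaoUllmo2025, §3.1 Thm. 3.1] [cite: Pohlmann1968, Thm. 1] -/
theorem finrank_hodgeClasses_eq_ncard_pohlmannSetsAlg_fin (h : IsCMAlgTorusRat P ρ) (p : ℕ) :
    finrank ℚ (hodgeClasses P p) = (pohlmannSetsAlg h.cmType p).ncard :=
  h.finrank_hodgeClasses_eq_ncard_pohlmannSetsAlg (Equiv.refl _) p

/-- **`ρ(X) = #pohlmannSetsAlg (Φᵢ)ᵢ 1`** for a torus with multiplication by `Y = L₀ ⊕ ⋯ ⊕ L_{n-1}`.
[cite: GaoUllmo2025, §3.1 Thm. 3.1] [cite: Lange2023AbelianVarietiesComplex, §1.3.4 Exercise (10)(b)] -/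
theorem finrank_neronSeveriGroup_eq_ncard_pohlmannSetsAlg_fin (h : IsCMAlgTorusRat P ρ) :
    finrank ℤ (neronSeveriGroup P) = (pohlmannSetsAlg h.cmType 1).ncard :=
  h.finrank_neronSeveriGroup_eq_ncard_pohlmannSetsAlg (Equiv.refl _)

end FinIndexed

end IsCMAlgTorusRat

end Literature.NumberTheory.ComplexMultiplication
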